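import Summits.QuantumAdvantage.QuantumAdvantage.Theorems.LinnikCubicClassGroupsDegreeOnePrimesEscapeClassPNTSmoothedMain
import Literature.NumberTheory.LFunctions.ClassGroupLFunctionExceptionalZeroEffective
import Literature.NumberTheory.LFunctions.DedekindZetaExplicitFormula
import HarnessLib

/-!
# The class prime number theorem with the Deuring–Heilbronn phenomenon, II: inputs

Topic `Summits/QuantumAdvantage/QuantumAdvantage/Theorems`, cell B2b-1 (linnik-cubic), PART A (gen 4);
helper toward the crux `DegreeOnePrimesEscape` (stmt-QuantumAdvantage-11543) of route
`LinnikCubicClassGroups`.  HONEST FRAMING: the value of this file is a THEOREM (kernel-checked,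
GRH-free) — NOT summit progress (the route still rests on the hypothesis-type target
`PureCubicClassNumberHard`).

Small inputs for the Deuring–Heilbronn form of the smoothed class prime number theorem (file III):

* `Residue.one_sub_realZero_ge_condQn_rpow` — Stark's effective bound in `Q`-form: for `K` of degree
  `n > 1`, every real zero `β < 1` of a real class group character satisfies `c₁(n) Q^{−2} ≤ 1 − β`
  (`Q = condQn K = |d_K| nⁿ`; from `classGroupLFunction_one_sub_realZero_ge'`);
* `classGroupLFunction_eq_zero_of_famF` — a zero `ρ ≠ 1` of `F_ψ` is a zero of `L(s, χ_ψ)`;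
* `zfr_of_zeroRepulsion` — the Deuring–Heilbronn repulsion
  `log(1/(Cℒ(1−β₁)))/(Cℒ) ≤ 1 − Re ρ`, `ℒ = log|d_K| + n(log(|γ|+2)+1)`, put in the shape consumed by
  `fam_zeroSum_le_local_zfr`: every zero `ρ` of the family with `1/4 ≤ Re ρ < 1`, `|γ| ≤ x`, off the
  exceptional segment, has `Re ρ ≤ 1 − c_Z/(a log Q + log(|γ|+4))` with
  `c_Z = min( log(1/(2Cn(1−β₁)log x))/(Cn), a log Q/2 )`, as long as `2Cn(1−β₁) log x ≤ 1/3`;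
(The real-variable bookkeeping — absorption of powers of `Q` by `x^{−ν}`, the two regimes of `c_Z` — is in
`…ClassPNTDHNumerics.lean`.)

References: J. Thorner, A. Zaman, Algebra Number Theory 13 (2019), §5 (proof of Thm. 1.4)
[ThornerZaman2019]; J. C. Lagarias, H. L. Montgomery, A. M. Odlyzko, Invent. Math. 54 (1979), §§5–7
[LagariasMontgomeryOdlyzko1979]; H. M. Stark, Invent. Math. 23 (1974) [Stark1974].
-/

noncomputable section

open Complex Real MeasureTheory Set Filter Topology
open scoped NumberField nonZeroDivisors

namespace Summit.QuantumAdvantage.QuantumAdvantage.Theorems.DegreeOnePrimesEscape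

open Literature.NumberTheory.LFunctions Literature.NumberTheory.LFunctions.NumberField
  Literature.NumberTheory.LFunctions.EntireEF Literature.NumberTheory.LFunctions.TZWeight
  Literature.NumberTheory.LFunctions.AbelianDensity

/-! ### Stark's effective repulsion of the exceptional zero, `Q`-form -/

/-- **`1 − β ≥ c₁(n)·Q^{−2}` for every real zero of every real class group character** of a number field
of degree `n > 1` (`Q = condQn K`): the window-free effective bound
`min(1/(8(2n)! log|d_K|), c|d_K|^{−1/n}(log|d_K|)^{−2}) ≤ 1 − β` of
`classGroupLFunction_one_sub_realZero_ge'` with `log|d_K| ≤ |d_K| ≤ Q`, `(log|d_K|)² ≤ 4|d_K|`,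
`|d_K|^{−1/n} ≥ |d_K|^{−1}`.  [cite: Stark1974, §1, Theorem 1'] -/
theorem Residue.one_sub_realZero_ge_condQn_rpow (n : ℕ) (hn : 1 < n) :
    ∃ c₁ : ℝ, 0 < c₁ ∧ c₁ ≤ 1 ∧ ∀ (K : Type) [Field K] [NumberField K], Module.finrank ℚ K = n →
      ∀ χ : ClassGroup (𝓞 K) →* ℂˣ, χ * χ = 1 → ∀ β : ℝ, β < 1 → classGroupLFunction K χ β = 0 →
        c₁ * ThornerZaman.condQn K ^ (-(2 : ℝ)) ≤ 1 - β := by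
  obtain ⟨c, hc, h⟩ := classGroupLFunction_one_sub_realZero_ge'
  have hfac : (0 : ℝ) < ((2 * n).factorial : ℝ) := by exact_mod_cast Nat.factorial_pos _
  refine ⟨min (min (c / 4) (1 / (8 * ((2 * n).factorial : ℝ)))) 1,
    lt_min (lt_min (by positivity) (by positivity)) one_pos, min_le_right _ _,
    fun K _ _ hKn χ hχ β hβ1 h0 => ?_⟩
  have hK : 1 < Module.finrank ℚ K := by rw [hKn]; exact hn
  have hmin := h K hK χ hχ β hβ1 h0
  rw [hKn] at hmin
  set Q : ℝ := ThornerZaman.condQn K with hQ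
  have hQ12 : (12 : ℝ) ≤ Q := ThornerZaman.twelve_le_condQn (K := K) hK
  have hQ1 : (1 : ℝ) ≤ Q := by linarith
  set d : ℝ := ((NumberField.discr K).natAbs : ℝ) with hd
  have hd3 : (3 : ℝ) ≤ d := by
    have h2 := NumberField.abs_discr_gt_two hK
    rw [hd, Nat.cast_natAbs]
    exact_mod_cast (show (3 : ℤ) ≤ |NumberField.discr K| by omega)
  have hd1 : (1 : ℝ) ≤ d := by linarith
  have hd0 : (0 : ℝ) < d := by linarith
  have hdQ : d ≤ Q := natAbs_discr_le_condQn K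
  have hlogd0 : 0 < Real.log d := Real.log_pos (by linarith)
  have hlogd_le : Real.log d ≤ d := by
    have := Real.log_le_sub_one_of_pos hd0; linarith
  -- `(log d)² ≤ 4 d`
  have hlog2 : Real.log d ^ 2 ≤ 4 * d := by
    have h1 : Real.log d ≤ d ^ ((1 : ℝ) / 2) / (1 / 2) := Real.log_le_rpow_div hd0.le (by norm_num)
    have h2 : Real.log d ≤ 2 * Real.sqrt d := by
      rw [Real.sqrt_eq_rpow]; linarith
    have h3 := Real.sq_sqrt hd0.le
    nlinarith [Real.sqrt_nonneg d]
  have hQ2 : Q ^ (-(2 : ℝ)) = 1 / Q ^ 2 := by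
    rw [Real.rpow_neg (by linarith), ← Real.rpow_natCast]; norm_num
  -- (i) `c₁ Q^{-2} ≤ 1/(8 (2n)! log d)`
  have hi : min (min (c / 4) (1 / (8 * ((2 * n).factorial : ℝ)))) 1 * Q ^ (-(2 : ℝ)) ≤
      1 / (8 * ((2 * n).factorial : ℝ) * Real.log d) := by
    rw [hQ2]
    have hle : min (min (c / 4) (1 / (8 * ((2 * n).factorial : ℝ)))) 1 ≤
        1 / (8 * ((2 * n).factorial : ℝ)) := (min_le_left _ _).trans (min_le_right _ _)
    have hlogQ2 : Real.log d ≤ Q ^ 2 := by nlinarith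
    calc min (min (c / 4) (1 / (8 * ((2 * n).factorial : ℝ)))) 1 * (1 / Q ^ 2)
        ≤ 1 / (8 * ((2 * n).factorial : ℝ)) * (1 / Q ^ 2) :=
          mul_le_mul_of_nonneg_right hle (by positivity)
      _ = 1 / (8 * ((2 * n).factorial : ℝ) * Q ^ 2) := by rw [one_div_mul_one_div]
      _ ≤ 1 / (8 * ((2 * n).factorial : ℝ) * Real.log d) := by
          refine one_div_le_one_div_of_le (by positivity) ?_
          exact mul_le_mul_of_nonneg_left hlogQ2 (by positivity)
  -- (ii) `c₁ Q^{-2} ≤ c d^{-1/n} / (log d)²`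
  have hii : min (min (c / 4) (1 / (8 * ((2 * n).factorial : ℝ)))) 1 * Q ^ (-(2 : ℝ)) ≤
      c * d ^ (-(1 : ℝ) / n) / Real.log d ^ 2 := by
    rw [hQ2]
    have hle : min (min (c / 4) (1 / (8 * ((2 * n).factorial : ℝ)))) 1 ≤ c / 4 :=
      (min_le_left _ _).trans (min_le_left _ _)
    have hn0 : (0 : ℝ) < n := by exact_mod_cast (lt_trans Nat.zero_lt_one hn)
    -- `d^{-1/n} ≥ d^{-1}`
    have hdn : d ^ (-(1 : ℝ)) ≤ d ^ (-(1 : ℝ) / n) := by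
      refine Real.rpow_le_rpow_of_exponent_le hd1 ?_
      rw [neg_div, neg_le_neg_iff, div_le_one hn0]
      exact_mod_cast hn.le
    have hdinv : d ^ (-(1 : ℝ)) = 1 / d := by rw [Real.rpow_neg hd0.le, Real.rpow_one, one_div]
    calc min (min (c / 4) (1 / (8 * ((2 * n).factorial : ℝ)))) 1 * (1 / Q ^ 2)
        ≤ c / 4 * (1 / Q ^ 2) := mul_le_mul_of_nonneg_right hle (by positivity)
      _ ≤ c / 4 * (1 / d ^ 2) := by
          refine mul_le_mul_of_nonneg_left ?_ (by positivity)
          exact one_div_le_one_div_of_le (by positivity) (by nlinarith)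
      _ = c * (1 / d) / (4 * d) := by field_simp
      _ ≤ c * d ^ (-(1 : ℝ) / n) / (4 * d) := by
          rw [← hdinv]; gcongr
      _ ≤ c * d ^ (-(1 : ℝ) / n) / Real.log d ^ 2 := by
          refine div_le_div_of_nonneg_left (by positivity) (by positivity) hlog2
  exact (le_min hi hii).trans hmin

/-! ### Zeros of the family are zeros of the `L`-functions -/

/-- A zero `ρ ≠ 1` of `F_ψ` (`= ζ₁_K` for `ψ = 0`, `L₀(·, χ_ψ)` otherwise) is a zero of `L(s, χ_ψ)`
(`= ζ_K` for `ψ = 0`). [folklore] -/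
theorem classGroupLFunction_eq_zero_of_famF {K : Type} [Field K] [NumberField K]
    (ψ : AddChar (Additive (ClassGroup (𝓞 K))) ℂ) {ρ : ℂ} (h0 : famF K ψ ρ = 0) (hρ1 : ρ ≠ 1) :
    classGroupLFunction K (toMulHom ψ).toHomUnits ρ = 0 := by
  by_cases hψ : ψ = 0
  · subst hψ
    rw [famF_zero] at h0
    rw [toHomUnits_toMulHom_zero]
    by_contra hne
    exact ((dedekindZeta₁_ne_zero_iff (K := K) hρ1).2 hne) h0
  · rw [famF_of_ne hψ, classGroupLFunction₀_eq _ hρ1 (toHomUnits_ne_one hψ)] at h0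
    exact h0

/-! ### The Deuring–Heilbronn repulsion in the shape of a zero-free region -/

/-- **Deuring–Heilbronn ⇒ zero-free region in `Q`-form.**  Let `K` have degree `n > 1`, `a ≥ 1`,
`Q = condQn K ≤ x`, `log x ≥ 4`, and let `β₁` lie on the exceptional segment `excRegion c K` with
`2Cn(1 − β₁) log x ≤ 1/3`, `β₁ < 1`.  If every zero `ρ` of every `L(s, χ)` (`χ ∈ Ĉl_K`) with
`Re ρ ≥ 1/2`, `ρ ≠ 1, β₁` satisfies `log(1/(Cℒ_ρ(1−β₁)))/(Cℒ_ρ) ≤ 1 − Re ρ`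
(`ℒ_ρ = log|d_K| + n(log(|Im ρ|+2)+1)`), then every zero `ρ` of every `F_ψ` with `1/4 ≤ Re ρ < 1`,
`|Im ρ| ≤ x`, off `excRegion c K`, satisfies `Re ρ ≤ 1 − c_Z/(a log Q + log(|Im ρ| + 4))`,
`c_Z = min( log(1/(2Cn(1−β₁) log x))/(Cn), a log Q / 2 )`.
[cite: LagariasMontgomeryOdlyzko1979, Theorem 5.1] [cite: ThornerZaman2019, §5] -/
theorem zfr_of_zeroRepulsion {K : Type} [Field K] [NumberField K] {n : ℕ} (hn : 1 < n)
    (hKn : Module.finrank ℚ K = n) {C : ℝ} (hC : 0 < C) {β₁ c a x : ℝ} (ha : 1 ≤ a)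
    (hexc₁ : excRegion c K (β₁ : ℂ)) (hβ1 : β₁ < 1) (hxQ : ThornerZaman.condQn K ≤ x)
    (hL4 : 4 ≤ Real.log x)
    (hrep : ∀ (χ : ClassGroup (𝓞 K) →* ℂˣ) (ρ : ℂ), classGroupLFunction K χ ρ = 0 → 1 / 2 ≤ ρ.re →
      ρ ≠ 1 → ρ ≠ β₁ →
        Real.log (1 / (C * (Real.log ((NumberField.discr K).natAbs : ℝ) +
            Module.finrank ℚ K * (Real.log (|ρ.im| + 2) + 1)) * (1 - β₁))) /
          (C * (Real.log ((NumberField.discr K).natAbs : ℝ) +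
            Module.finrank ℚ K * (Real.log (|ρ.im| + 2) + 1))) ≤ 1 - ρ.re)
    (hsmall : 2 * C * n * ((1 - β₁) * Real.log x) ≤ 1 / 3) :
    ∀ (ψ : AddChar (Additive (ClassGroup (𝓞 K))) ℂ) (ρ : ℂ), famF K ψ ρ = 0 → 1 / 4 ≤ ρ.re →
      ρ.re < 1 → |ρ.im| ≤ x → ¬ excRegion c K ρ →
        ρ.re ≤ 1 - min (Real.log (1 / (2 * C * n * ((1 - β₁) * Real.log x))) / (C * n))
          (a * Real.log (ThornerZaman.condQn K) / 2) /
          (a * Real.log (ThornerZaman.condQn K) + Real.log (|ρ.im| + 4)) := by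
  intro ψ ρ h0 _ hre1 hγ hexc
  have hK : 1 < Module.finrank ℚ K := by rw [hKn]; exact hn
  set Q : ℝ := ThornerZaman.condQn K with hQ
  have hQ12 : (12 : ℝ) ≤ Q := ThornerZaman.twelve_le_condQn (K := K) hK
  have hlog12 : (2 : ℝ) ≤ Real.log 12 := by
    rw [Real.le_log_iff_exp_le (by norm_num)]
    have := Real.exp_one_lt_d9
    have h : Real.exp 2 = Real.exp 1 * Real.exp 1 := by rw [← Real.exp_add]; norm_num
    rw [h]; nlinarith [Real.exp_pos (1:ℝ)]
  have hlogQ : 2 ≤ Real.log Q := hlog12.trans (Real.log_le_log (by norm_num) hQ12)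
  have hn2 : (2 : ℝ) ≤ n := by exact_mod_cast hn
  have hx12 : (12 : ℝ) ≤ x := hQ12.trans hxQ
  have hx0 : 0 < x := by linarith
  set L : ℝ := Real.log x with hL
  set δ₁ : ℝ := 1 - β₁ with hδ₁
  have hδ₁0 : 0 < δ₁ := by rw [hδ₁]; linarith
  have hlog4 : 0 < Real.log (|ρ.im| + 4) := Real.log_pos (by linarith [abs_nonneg ρ.im])
  set Dn : ℝ := a * Real.log Q + Real.log (|ρ.im| + 4) with hDn
  have hDn0 : 0 < Dn := by rw [hDn]; nlinarith
  set cZ : ℝ := min (Real.log (1 / (2 * C * n * (δ₁ * L))) / (C * n)) (a * Real.log Q / 2) with hcZ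
  rcases lt_or_ge ρ.re (1 / 2) with hlt | hge
  · -- `Re ρ < 1/2`: `c_Z ≤ a log Q / 2 ≤ Dn / 2`
    have h1 : cZ / Dn ≤ 1 / 2 := by
      rw [div_le_iff₀ hDn0]
      have : cZ ≤ a * Real.log Q / 2 := min_le_right _ _
      rw [hDn]; nlinarith
    linarith
  · -- `Re ρ ≥ 1/2`: the repulsion
    have hρ1 : ρ ≠ 1 := by
      intro h; rw [h, Complex.one_re] at hre1; exact lt_irrefl _ hre1
    have hρβ : ρ ≠ (β₁ : ℂ) := by
      intro h; rw [h] at hexc; exact hexc hexc₁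
    have hLρ := classGroupLFunction_eq_zero_of_famF ψ h0 hρ1
    have key := hrep _ ρ hLρ hge hρ1 hρβ
    rw [hKn] at key
    set d : ℝ := ((NumberField.discr K).natAbs : ℝ) with hd
    have hd0 : (0 : ℝ) < d := by
      rw [hd]; exact_mod_cast Nat.pos_of_ne_zero (Int.natAbs_ne_zero.2 (NumberField.discr_ne_zero K))
    have hdQ : d ≤ Q := natAbs_discr_le_condQn K
    have hlogd0 : 0 ≤ Real.log d := by rw [hd]; exact Real.log_natCast_nonneg _
    have hlogdQ : Real.log d ≤ Real.log Q := Real.log_le_log hd0 hdQ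
    have hlogQL : Real.log Q ≤ L := Real.log_le_log (by linarith) hxQ
    have hlog2 : 0 < Real.log (|ρ.im| + 2) := Real.log_pos (by linarith [abs_nonneg ρ.im])
    set ℒ : ℝ := Real.log d + n * (Real.log (|ρ.im| + 2) + 1) with hℒ
    have hℒ0 : 0 < ℒ := by rw [hℒ]; positivity
    -- `ℒ ≤ 2 n L`
    have hlogx2 : Real.log (|ρ.im| + 2) ≤ L + 1 := by
      have h1 : Real.log (|ρ.im| + 2) ≤ Real.log (x + 2) :=
        Real.log_le_log (by linarith [abs_nonneg ρ.im]) (by linarith)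
      have h2 : x + 2 ≤ Real.exp 1 * x := by
        have := Real.exp_one_gt_d9; nlinarith
      have h3 : Real.log (x + 2) ≤ Real.log (Real.exp 1 * x) := Real.log_le_log (by linarith) h2
      rw [Real.log_mul (Real.exp_pos 1).ne' hx0.ne', Real.log_exp] at h3
      linarith
    have hℒL : ℒ ≤ 2 * n * L := by
      rw [hℒ]
      have h1 : (n : ℝ) * (Real.log (|ρ.im| + 2) + 1) ≤ n * (L + 2) := by
        refine mul_le_mul_of_nonneg_left ?_ (by linarith); linarith
      -- `log d + n (L + 2) ≤ L + nL + 2n ≤ 2nL` as `(n - 1) L ≥ 4 (n - 1) ≥ 2n`... with `L ≥ 4`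
      have h2 : ((n : ℝ) - 1) * 4 ≤ ((n : ℝ) - 1) * L := mul_le_mul_of_nonneg_left hL4 (by linarith)
      have h3 : Real.log d ≤ L := hlogdQ.trans hlogQL
      have e : (n : ℝ) * (L + 2) = n * L + 2 * n := by ring
      have e2 : 2 * (n : ℝ) * L = n * L + (((n : ℝ) - 1) * L + L) := by ring
      linarith
    -- `ℒ ≤ n Dn`
    have hℒD : ℒ ≤ n * Dn := by
      rw [hℒ, hDn]
      have h1 : Real.log (|ρ.im| + 2) ≤ Real.log (|ρ.im| + 4) :=
        Real.log_le_log (by linarith [abs_nonneg ρ.im]) (by linarith)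
      have h2 : Real.log d + n ≤ n * (a * Real.log Q) := by
        have h21 : Real.log Q ≤ a * Real.log Q := by nlinarith
        have h22 : (n : ℝ) * Real.log Q ≤ n * (a * Real.log Q) :=
          mul_le_mul_of_nonneg_left h21 (by linarith)
        -- `n log Q = log Q + (n - 1) log Q ≥ log d + 2 (n - 1) ≥ log d + n`
        have h23 : ((n : ℝ) - 1) * 2 ≤ ((n : ℝ) - 1) * Real.log Q :=
          mul_le_mul_of_nonneg_left hlogQ (by linarith)
        have h24 : (n : ℝ) * Real.log Q = Real.log Q + ((n : ℝ) - 1) * Real.log Q := by ring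
        linarith
      have h3 : (n : ℝ) * Real.log (|ρ.im| + 2) ≤ n * Real.log (|ρ.im| + 4) :=
        mul_le_mul_of_nonneg_left h1 (by linarith)
      have e : Real.log d + n * (Real.log (|ρ.im| + 2) + 1) =
          (Real.log d + n) + n * Real.log (|ρ.im| + 2) := by ring
      have e' : (n : ℝ) * (a * Real.log Q + Real.log (|ρ.im| + 4)) =
          n * (a * Real.log Q) + n * Real.log (|ρ.im| + 4) := by ring
      rw [e, e']
      linarith
    -- `t = C ℒ δ₁ ≤ 2 C n δ₁ L ≤ 1/3`
    set t : ℝ := C * ℒ * δ₁ with ht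
    have ht0 : 0 < t := by positivity
    have htle : t ≤ 2 * C * n * (δ₁ * L) := by
      rw [ht]
      have h1 : C * ℒ ≤ C * (2 * n * L) := mul_le_mul_of_nonneg_left hℒL hC.le
      have h2 : C * ℒ * δ₁ ≤ C * (2 * n * L) * δ₁ := mul_le_mul_of_nonneg_right h1 hδ₁0.le
      linarith
    have ht1 : t ≤ 1 / 3 := htle.trans hsmall
    have hsm0 : 0 < 2 * C * n * (δ₁ * L) := lt_of_lt_of_le ht0 htle
    -- `ℓ = log(1/(2Cnδ₁L)) ≤ log(1/t)`, `ℓ ≥ 0`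
    set ℓ : ℝ := Real.log (1 / (2 * C * n * (δ₁ * L))) with hℓ
    have hℓle : ℓ ≤ Real.log (1 / t) := by
      rw [hℓ]; exact Real.log_le_log (by positivity) (one_div_le_one_div_of_le ht0 htle)
    have hℓ0 : 0 ≤ ℓ := by
      rw [hℓ]; refine Real.log_nonneg ?_
      rw [le_div_iff₀ hsm0]; linarith
    have hlogt0 : 0 ≤ Real.log (1 / t) := hℓ0.trans hℓle
    -- the chain
    -- (`set` has rewritten `key` to `log(1/t)/(Cℒ) ≤ 1 − Re ρ`)
    have hkey' : Real.log (1 / t) / (C * ℒ) ≤ 1 - ρ.re := key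
    have h1 : cZ / Dn ≤ ℓ / (C * n) / Dn :=
      div_le_div_of_nonneg_right (min_le_left _ _) hDn0.le
    have h2 : ℓ / (C * n) / Dn = ℓ / (C * (n * Dn)) := by
      rw [div_div]; ring_nf
    have h3 : ℓ / (C * (n * Dn)) ≤ Real.log (1 / t) / (C * (n * Dn)) :=
      div_le_div_of_nonneg_right hℓle (by positivity)
    have h4 : Real.log (1 / t) / (C * (n * Dn)) ≤ Real.log (1 / t) / (C * ℒ) :=
      div_le_div_of_nonneg_left hlogt0 (by positivity) (mul_le_mul_of_nonneg_left hℒD hC.le)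
    have : cZ / Dn ≤ 1 - ρ.re := by
      calc cZ / Dn ≤ ℓ / (C * n) / Dn := h1
        _ = ℓ / (C * (n * Dn)) := h2
        _ ≤ Real.log (1 / t) / (C * (n * Dn)) := h3
        _ ≤ Real.log (1 / t) / (C * ℒ) := h4
        _ ≤ 1 - ρ.re := hkey'
    linarith

end Summit.QuantumAdvantage.QuantumAdvantage.Theorems.DegreeOnePrimesEscape

end
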